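import Mathlib
import HarnessLib
import Summits.HubbardSuperconductivity.HubbardSuperconductivity.Theorems.KLProgrammeC4aPPKernelPiecesJetsAllOrders

/-!
# Route `KLProgramme` — crux C4a, S3 brick (B4) «(B4)-UMK1», «(U1)-K-JETS-ALL-ORDERS» part 4: the product-form pp kernel is JOINTLY `C^∞` ON `ℝ²` —
# `contDiff_ppTrueKernel₂ : ContDiff ℝ ∞ (fun p => ppTrueKernel β Λ p.1 p.2)`, and so are the pieces `A_s`, `M_s` and all slice jets

Cell `gate-hubbard-kl`, seat hubbard-kl-k3c3-p1 (g20; row «δμ-flow with klAngularMean constant piece»).  The `u`-jets chain (`…TrueJets{Core,AllOrders,Joint}`,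
`…PiecesJetsAllOrders`) treats `e` as a parameter; laws that differentiate the kernel ALONG CURVES in the level plane (the flatness identities along the anti-diagonal
`u = D − e` of `…MidFlatnessIdentity` / `…FarSFlatnessIdentity`, a caustic-straightening change of variables of the (γ) architecture) want the kernel as ONE smooth
function of `(e,u)`.  The summand factorises, `sₙ(e,u) = Re[F_ωₙ(e)·G_ωₙ(u)]` with `F_ω(e) = W(ω,e)·(i(−ω)+e)⁻¹`, `G_ω(u) = W(ω,u)·(iω+u)⁻¹`, so Mathlib's `contDiff_tsum`
on `ℝ²` applies with the product of the one-variable jet tables: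
* §1 `norm_iteratedDeriv_weightMoebius_le` — `‖∂ⁱ[W(ω,·)·(iω′+·)⁻¹](x)‖ ≤ (i+1)!·X·Aⁱ·(1/|ω′|)` for `4/Λ ≤ A`, `1/|ω′| ≤ A` (Leibniz, part 1's weight jets, the Möbius jets
  of `…ModelWindowJets`); `contDiff_weightMoebius`;
* §2 the summand on `ℝ²`: `ppKernelSummand_eq_re_prod`, and the uniform table **`norm_iteratedFDeriv_ppKernelSummand₂_le`**
  (`‖D^m sₙ(p)‖ ≤ 2ᵐ·((m+1)!·X·Aᵐ)²·(1/ωₙ²)`, `A = max(max(4/Λ, β/π), 1)`) via `norm_iteratedFDeriv_mul_le`, `ContinuousLinearMap.iteratedFDeriv_comp_right`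
  (`fst`, `snd` have norm `≤ 1`) and `ContinuousLinearMap.norm_iteratedFDeriv_comp_left` (`‖re‖ = 1`);
* §3 **`contDiff_ppTrueKernel₂`** (hypothesis-free: the cutoff table is the Literature Gevrey one, order by order), `contDiff_ppFarKernelS₂`, `contDiff_ppMidKernelS₂`,
  the generic `contDiff_iteratedDeriv_slice₂` (the `u`-jets of a jointly smooth `g` form a jointly smooth function of `(e,u)`) and `contDiff_jet_ppTrueKernel₂`
  (`(e,u) ↦ ∂ᵤᵃP(e,u)` is jointly `C^∞` for every `a` — so every mixed jet exists and is continuous).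
Pure real/complex analysis on landed objects; nothing asserts (C), any engine row, K3, the window or superconductivity.
References: BGM 2006 §2.1 (2.3)–(2.4), §2.4 (2.36) [cite: BenfattoGiulianiMastropietro2006]; Salmhofer 1999 §4.2.5 (4.70)–(4.71) [cite: Salmhofer1999].
-/

noncomputable section

namespace Summit.HubbardSuperconductivity.HubbardSuperconductivity.Theorems.C4a

set_option linter.dupNamespace false -- summit = problem name (single-conjunct summit), D-0017

open Real Filter Set Finset Complex
open scoped Topology Nat
open Literature.MathematicalPhysics.QuantumLattice Literature.Analysis.SpecialFunctions Literature.Analysis.Calculus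

/-! ## §1 The one-variable factor `x ↦ W(ω,x)·(iω′+x)⁻¹` -/

/-- The weight cast to `ℂ` is `C^∞`. [folklore] -/
theorem contDiff_uvWeightFn_ofReal (Λ ω : ℝ) {N : ℕ∞} : ContDiff ℝ N (fun x : ℝ => (uvWeightFn Λ ω x : ℂ)) :=
  Complex.ofRealCLM.contDiff.comp (contDiff_uvWeightFn_band Λ ω)

/-- `‖∂ʲ(W : ℂ)(x)‖ = |∂ʲW(x)|`. [folklore] -/
theorem norm_iteratedDeriv_uvWeightFn_ofReal (Λ ω : ℝ) (j : ℕ) (x : ℝ) :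
    ‖iteratedDeriv j (fun x : ℝ => (uvWeightFn Λ ω x : ℂ)) x‖ = |iteratedDeriv j (fun x : ℝ => uvWeightFn Λ ω x) x| := by
  have hfun : (fun x : ℝ => (uvWeightFn Λ ω x : ℂ)) = Complex.ofRealLI ∘ fun x : ℝ => uvWeightFn Λ ω x := by funext x; rfl
  rw [← Real.norm_eq_abs, ← norm_iteratedFDeriv_eq_norm_iteratedDeriv, ← norm_iteratedFDeriv_eq_norm_iteratedDeriv, hfun,
    Complex.ofRealLI.norm_iteratedFDeriv_comp_left ((contDiff_uvWeightFn_band Λ ω (N := ⊤)).contDiffAt) (by exact_mod_cast le_top)]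

/-- The weight × Möbius factor is `C^∞` (`ω′ ≠ 0`). [folklore] -/
theorem contDiff_weightMoebius (Λ ω : ℝ) {ω' : ℝ} (hω' : ω' ≠ 0) {N : ℕ∞} :
    ContDiff ℝ N (fun x : ℝ => (uvWeightFn Λ ω x : ℂ) * (I * ω' + (x : ℂ))⁻¹) :=
  (contDiff_uvWeightFn_ofReal Λ ω).mul (contDiff_inv_I hω')

/-- **Jets of the weight × Möbius factor**: `‖∂ⁱ[W(ω,·)·(iω′+·)⁻¹](x)‖ ≤ (i+1)!·X·Aⁱ·(1/|ω′|)` whenever `4/Λ ≤ A`, `1/|ω′| ≤ A` (`0 < Λ`, `ω′ ≠ 0`, cutoff jets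
`≤ X` to order `i`). [cite: BenfattoGiulianiMastropietro2006, §2.4 (2.36)] -/
theorem norm_iteratedDeriv_weightMoebius_le {Λ : ℝ} (hΛ : 0 < Λ) (ω : ℝ) {ω' : ℝ} (hω' : ω' ≠ 0) {i : ℕ} {X : ℝ}
    (hX : ∀ l ≤ i, ∀ x : ℝ, ‖iteratedFDeriv ℝ l salmhoferCutoff x‖ ≤ X) {A : ℝ} (hA1 : 4 / Λ ≤ A) (hA2 : 1 / |ω'| ≤ A) (x : ℝ) :
    ‖iteratedDeriv i (fun x : ℝ => (uvWeightFn Λ ω x : ℂ) * (I * ω' + (x : ℂ))⁻¹) x‖ ≤ (i + 1)! * X * A ^ i * (1 / |ω'|) := by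
  have hX0 : 0 ≤ X := zero_le_one.trans (one_le_of_cutoff_jets hX)
  have hA0 : 0 ≤ A := le_trans (by positivity) hA1
  have hω0 : 0 < 1 / |ω'| := by positivity
  have h := norm_iteratedDeriv_mul_le (n := i) (contDiff_uvWeightFn_ofReal Λ ω) (contDiff_inv_I hω') x
  refine h.trans ?_
  have hterm : ∀ j ∈ Finset.range (i + 1), (i.choose j : ℝ) * ‖iteratedDeriv j (fun x : ℝ => (uvWeightFn Λ ω x : ℂ)) x‖ *
      ‖iteratedDeriv (i - j) (fun x : ℝ => (I * ω' + (x : ℂ))⁻¹) x‖ ≤ i ! * X * A ^ i * (1 / |ω'|) := by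
    intro j hj
    have hji : j ≤ i := Nat.lt_succ_iff.1 (Finset.mem_range.1 hj)
    rw [norm_iteratedDeriv_uvWeightFn_ofReal]
    have hW := abs_iteratedDeriv_uvWeightFn_le hΛ ω (fun l hl y => hX l (hl.trans hji) y) x
    have hM := norm_iteratedDeriv_inv_I_le hω' (i - j) x
    have hchoose : (i.choose j : ℝ) * (j ! : ℝ) * ((i - j)! : ℝ) = i ! := by exact_mod_cast Nat.choose_mul_factorial_mul_factorial hji
    have hp1 : (4 / Λ) ^ j ≤ A ^ j := pow_le_pow_left₀ (by positivity) hA1 j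
    have hp2 : (1 / |ω'|) ^ (i - j) ≤ A ^ (i - j) := pow_le_pow_left₀ hω0.le hA2 _
    calc (i.choose j : ℝ) * |iteratedDeriv j (fun x : ℝ => uvWeightFn Λ ω x) x| * ‖iteratedDeriv (i - j) (fun x : ℝ => (I * ω' + (x : ℂ))⁻¹) x‖
        ≤ (i.choose j : ℝ) * (j ! * X * (4 / Λ) ^ j) * ((i - j)! * (1 / |ω'|) ^ (i - j + 1)) := by gcongr
      _ = ((i.choose j : ℝ) * (j ! : ℝ) * ((i - j)! : ℝ)) * X * ((4 / Λ) ^ j * (1 / |ω'|) ^ (i - j)) * (1 / |ω'|) := by rw [pow_succ]; ring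
      _ ≤ (i ! : ℝ) * X * (A ^ j * A ^ (i - j)) * (1 / |ω'|) := by rw [hchoose]; gcongr
      _ = i ! * X * A ^ i * (1 / |ω'|) := by rw [← pow_add, Nat.add_sub_cancel' hji]
  calc ∑ j ∈ Finset.range (i + 1), (i.choose j : ℝ) * ‖iteratedDeriv j (fun x : ℝ => (uvWeightFn Λ ω x : ℂ)) x‖ *
        ‖iteratedDeriv (i - j) (fun x : ℝ => (I * ω' + (x : ℂ))⁻¹) x‖
      ≤ ∑ _j ∈ Finset.range (i + 1), (i ! : ℝ) * X * A ^ i * (1 / |ω'|) := Finset.sum_le_sum hterm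
    _ = (i + 1) * (i ! * X * A ^ i * (1 / |ω'|)) := by rw [Finset.sum_const, Finset.card_range, nsmul_eq_mul]; push_cast; ring
    _ = (i + 1)! * X * A ^ i * (1 / |ω'|) := by rw [Nat.factorial_succ]; push_cast; ring

/-! ## §2 The summand as a function on `ℝ²` -/

/-- `sₙ(e,u) = Re[(W(ωₙ,e)(i(−ωₙ)+e)⁻¹)·(W(ωₙ,u)(iωₙ+u)⁻¹)]`. [cite: BenfattoGiulianiMastropietro2006, §2.1 (2.3)] -/
theorem ppKernelSummand_eq_re_prod (β Λ e u : ℝ) (n : ℕ) :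
    ppKernelSummand β Λ e u n =
      (((uvWeightFn Λ (ppFreq β n) e : ℂ) * (I * ((-ppFreq β n : ℝ) : ℂ) + (e : ℂ))⁻¹) *
        ((uvWeightFn Λ (ppFreq β n) u : ℂ) * (I * ppFreq β n + (u : ℂ))⁻¹)).re := by
  have h1 : ((uvWeightFn Λ (ppFreq β n) e : ℂ) * (I * ((-ppFreq β n : ℝ) : ℂ) + (e : ℂ))⁻¹) *
      ((uvWeightFn Λ (ppFreq β n) u : ℂ) * (I * ppFreq β n + (u : ℂ))⁻¹) =
      ((uvWeightFn Λ (ppFreq β n) e * uvWeightFn Λ (ppFreq β n) u : ℝ) : ℂ) *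
        ((-I * ppFreq β n + (e : ℂ))⁻¹ * (I * ppFreq β n + (u : ℂ))⁻¹) := by
    have hc : I * ((-ppFreq β n : ℝ) : ℂ) + (e : ℂ) = -I * ppFreq β n + (e : ℂ) := by push_cast; ring
    rw [hc]; push_cast; ring
  rw [h1, Complex.re_ofReal_mul, re_inv_mul_inv_eq]
  rfl

/-- `‖D^i (f ∘ fst)(p)‖ ≤ ‖∂ⁱf(p.1)‖` and `‖D^i (g ∘ snd)(p)‖ ≤ ‖∂ⁱg(p.2)‖` for smooth `f g : ℝ → ℂ`. [folklore] -/
theorem norm_iteratedFDeriv_comp_fst_snd_le {f g : ℝ → ℂ} (hf : ContDiff ℝ (⊤ : ℕ∞) f) (hg : ContDiff ℝ (⊤ : ℕ∞) g) (i : ℕ) (p : ℝ × ℝ) :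
    ‖iteratedFDeriv ℝ i (fun q : ℝ × ℝ => f q.1) p‖ ≤ ‖iteratedDeriv i f p.1‖ ∧ ‖iteratedFDeriv ℝ i (fun q : ℝ × ℝ => g q.2) p‖ ≤ ‖iteratedDeriv i g p.2‖ := by
  have hi : ((i : ℕ∞) : WithTop ℕ∞) ≤ ((⊤ : ℕ∞) : WithTop ℕ∞) := by exact_mod_cast le_top
  constructor
  · have hfun : (fun q : ℝ × ℝ => f q.1) = f ∘ (ContinuousLinearMap.fst ℝ ℝ ℝ) := rfl
    rw [hfun, ContinuousLinearMap.iteratedFDeriv_comp_right _ hf p hi, ← norm_iteratedFDeriv_eq_norm_iteratedDeriv]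
    refine (ContinuousMultilinearMap.norm_compContinuousLinearMap_le _ _).trans ?_
    have h1 : ∏ _j : Fin i, ‖ContinuousLinearMap.fst ℝ ℝ ℝ‖ ≤ 1 :=
      Finset.prod_le_one (fun _ _ => norm_nonneg _) fun _ _ => ContinuousLinearMap.norm_fst_le ℝ ℝ ℝ
    calc ‖iteratedFDeriv ℝ i f ((ContinuousLinearMap.fst ℝ ℝ ℝ) p)‖ * ∏ _j : Fin i, ‖ContinuousLinearMap.fst ℝ ℝ ℝ‖
        ≤ ‖iteratedFDeriv ℝ i f ((ContinuousLinearMap.fst ℝ ℝ ℝ) p)‖ * 1 := mul_le_mul_of_nonneg_left h1 (norm_nonneg _)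
      _ = ‖iteratedFDeriv ℝ i f p.1‖ := by rw [mul_one]; rfl
  · have hfun : (fun q : ℝ × ℝ => g q.2) = g ∘ (ContinuousLinearMap.snd ℝ ℝ ℝ) := rfl
    rw [hfun, ContinuousLinearMap.iteratedFDeriv_comp_right _ hg p hi, ← norm_iteratedFDeriv_eq_norm_iteratedDeriv]
    refine (ContinuousMultilinearMap.norm_compContinuousLinearMap_le _ _).trans ?_
    have h1 : ∏ _j : Fin i, ‖ContinuousLinearMap.snd ℝ ℝ ℝ‖ ≤ 1 :=
      Finset.prod_le_one (fun _ _ => norm_nonneg _) fun _ _ => ContinuousLinearMap.norm_snd_le ℝ ℝ ℝ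
    calc ‖iteratedFDeriv ℝ i g ((ContinuousLinearMap.snd ℝ ℝ ℝ) p)‖ * ∏ _j : Fin i, ‖ContinuousLinearMap.snd ℝ ℝ ℝ‖
        ≤ ‖iteratedFDeriv ℝ i g ((ContinuousLinearMap.snd ℝ ℝ ℝ) p)‖ * 1 := mul_le_mul_of_nonneg_left h1 (norm_nonneg _)
      _ = ‖iteratedFDeriv ℝ i g p.2‖ := by rw [mul_one]; rfl

/-- **The uniform 2D jet table of one summand**: `‖D^m sₙ(p)‖ ≤ 2ᵐ·((m+1)!·X·Aᵐ)²·(1/(ωₙ²+0²))` with `A = max(max(4/Λ, β/π), 1)`, for every `p : ℝ²`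
(cutoff jets `≤ X` to order `m`). [cite: BenfattoGiulianiMastropietro2006, §2.1 (2.3)-(2.4)] -/
theorem norm_iteratedFDeriv_ppKernelSummand₂_le {β Λ : ℝ} (hβ : 0 < β) (hΛ : 0 < Λ) {m : ℕ} {X : ℝ}
    (hX : ∀ l ≤ m, ∀ x : ℝ, ‖iteratedFDeriv ℝ l salmhoferCutoff x‖ ≤ X) (n : ℕ) (p : ℝ × ℝ) :
    ‖iteratedFDeriv ℝ m (fun q : ℝ × ℝ => ppKernelSummand β Λ q.1 q.2 n) p‖ ≤
      2 ^ m * ((m + 1)! * X * (max (max (4 / Λ) (β / π)) 1) ^ m) ^ 2 * (1 / (ppFreq β n ^ 2 + 0 ^ 2)) := by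
  have hω := ppFreq_pos hβ n
  have hX0 : 0 ≤ X := zero_le_one.trans (one_le_of_cutoff_jets hX)
  set ω := ppFreq β n with hω_def
  set A : ℝ := max (max (4 / Λ) (β / π)) 1 with hA_def
  have hA1 : 4 / Λ ≤ A := (le_max_left _ _).trans (le_max_left _ _)
  have hAω : 1 / |ω| ≤ A := by
    refine le_trans ?_ ((le_max_right _ _).trans (le_max_left _ _))
    rw [abs_of_pos hω, div_le_div_iff₀ hω Real.pi_pos, one_mul]
    have := pi_div_le_ppFreq hβ n
    rw [← hω_def, div_le_iff₀ hβ] at this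
    linarith
  have hAω' : 1 / |(-ω)| ≤ A := by rwa [abs_neg]
  have hAone : 1 ≤ A := le_max_right _ _
  have hωn : (-ω) ≠ 0 := neg_ne_zero.2 hω.ne'
  -- the two factors
  set F : ℝ → ℂ := fun x => (uvWeightFn Λ ω x : ℂ) * (I * ((-ω : ℝ) : ℂ) + (x : ℂ))⁻¹ with hF
  set G : ℝ → ℂ := fun x => (uvWeightFn Λ ω x : ℂ) * (I * ω + (x : ℂ))⁻¹ with hG
  have hFc : ContDiff ℝ (⊤ : ℕ∞) F := contDiff_weightMoebius Λ ω hωn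
  have hGc : ContDiff ℝ (⊤ : ℕ∞) G := contDiff_weightMoebius Λ ω hω.ne'
  -- the summand is `re ∘ (F ⊗ G)`
  have hfun : (fun q : ℝ × ℝ => ppKernelSummand β Λ q.1 q.2 n) = Complex.reCLM ∘ fun q : ℝ × ℝ => F q.1 * G q.2 := by
    funext q
    rw [Function.comp_apply, Complex.reCLM_apply, ppKernelSummand_eq_re_prod β Λ q.1 q.2 n]
  have hprod : ContDiff ℝ (⊤ : ℕ∞) fun q : ℝ × ℝ => F q.1 * G q.2 := (hFc.comp contDiff_fst).mul (hGc.comp contDiff_snd)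
  have hm : ((m : ℕ∞) : WithTop ℕ∞) ≤ ((⊤ : ℕ∞) : WithTop ℕ∞) := by exact_mod_cast le_top
  rw [hfun]
  refine (ContinuousLinearMap.norm_iteratedFDeriv_comp_left _ hprod.contDiffAt hm).trans ?_
  rw [Complex.reCLM_norm, one_mul]
  refine (norm_iteratedFDeriv_mul_le (hFc.comp contDiff_fst) (hGc.comp contDiff_snd) p hm).trans ?_
  -- monotonicity of the one-variable table to the top order `m`
  have hmono : ∀ j ≤ m, ((j + 1)! : ℝ) * X * A ^ j * (1 / ω) ≤ (m + 1)! * X * A ^ m * (1 / ω) := by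
    intro j hj
    have hf : ((j + 1)! : ℝ) ≤ (m + 1)! := by exact_mod_cast Nat.factorial_le (by omega)
    have hp : A ^ j ≤ A ^ m := pow_le_pow_right₀ hAone hj
    gcongr
  have hsq : ((m + 1)! * X * A ^ m * (1 / ω)) * ((m + 1)! * X * A ^ m * (1 / ω)) = ((m + 1)! * X * A ^ m) ^ 2 * (1 / (ω ^ 2 + 0 ^ 2)) := by
    rw [zero_pow two_ne_zero, add_zero]; field_simp
  -- each Leibniz term
  have hterm : ∀ i ∈ Finset.range (m + 1), (m.choose i : ℝ) * ‖iteratedFDeriv ℝ i (fun q : ℝ × ℝ => F q.1) p‖ *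
      ‖iteratedFDeriv ℝ (m - i) (fun q : ℝ × ℝ => G q.2) p‖ ≤ (m.choose i : ℝ) * (((m + 1)! * X * A ^ m) ^ 2 * (1 / (ω ^ 2 + 0 ^ 2))) := by
    intro i hi
    have him : i ≤ m := Nat.lt_succ_iff.1 (Finset.mem_range.1 hi)
    obtain ⟨h1, -⟩ := norm_iteratedFDeriv_comp_fst_snd_le hFc hGc i p
    obtain ⟨-, h2⟩ := norm_iteratedFDeriv_comp_fst_snd_le hFc hGc (m - i) p
    have hb1 := norm_iteratedDeriv_weightMoebius_le hΛ ω hωn (fun l hl y => hX l (hl.trans him) y) hA1 hAω' p.1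
    have hb2 := norm_iteratedDeriv_weightMoebius_le hΛ ω hω.ne' (fun l hl y => hX l (hl.trans (Nat.sub_le m i)) y) hA1 hAω p.2
    rw [abs_neg, abs_of_pos hω] at hb1
    rw [abs_of_pos hω] at hb2
    rw [mul_assoc]
    refine mul_le_mul_of_nonneg_left ?_ (Nat.cast_nonneg _)
    calc ‖iteratedFDeriv ℝ i (fun q : ℝ × ℝ => F q.1) p‖ * ‖iteratedFDeriv ℝ (m - i) (fun q : ℝ × ℝ => G q.2) p‖
        ≤ ((i + 1)! * X * A ^ i * (1 / ω)) * (((m - i) + 1)! * X * A ^ (m - i) * (1 / ω)) :=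
          mul_le_mul (h1.trans hb1) (h2.trans hb2) (norm_nonneg _) (by positivity)
      _ ≤ ((m + 1)! * X * A ^ m * (1 / ω)) * ((m + 1)! * X * A ^ m * (1 / ω)) :=
          mul_le_mul (hmono i him) (hmono (m - i) (Nat.sub_le m i)) (by positivity) (by positivity)
      _ = ((m + 1)! * X * A ^ m) ^ 2 * (1 / (ω ^ 2 + 0 ^ 2)) := hsq
  refine (Finset.sum_le_sum hterm).trans (le_of_eq ?_)
  rw [← Finset.sum_mul]
  have h2m : ∑ i ∈ Finset.range (m + 1), (m.choose i : ℝ) = 2 ^ m := by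
    have := Nat.sum_range_choose m
    exact_mod_cast this
  rw [h2m]; ring

/-! ## §3 Joint smoothness of the kernel, of the pieces, and of every slice jet -/

/-- **`P` IS JOINTLY `C^∞` ON `ℝ²`**: `ContDiff ℝ ∞ (fun p => ppTrueKernel β Λ p.1 p.2)` (`0 < β`, `0 < Λ`; hypothesis-free — the cutoff table is the Literature
Gevrey one at each order). [cite: BenfattoGiulianiMastropietro2006, §2.4 (2.36)] -/
theorem contDiff_ppTrueKernel₂ {β Λ : ℝ} (hβ : 0 < β) (hΛ : 0 < Λ) : ContDiff ℝ (⊤ : ℕ∞) fun p : ℝ × ℝ => ppTrueKernel β Λ p.1 p.2 := by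
  have hfun : (fun p : ℝ × ℝ => ppTrueKernel β Λ p.1 p.2) = fun p : ℝ × ℝ => 2 / β * ∑' n : ℕ, ppKernelSummand β Λ p.1 p.2 n := rfl
  rw [hfun]
  refine contDiff_const.mul ?_
  have hsummand : ∀ n : ℕ, ContDiff ℝ (⊤ : ℕ∞) fun p : ℝ × ℝ => ppKernelSummand β Λ p.1 p.2 n := by
    intro n
    have hω := ppFreq_pos hβ n
    have hfun' : (fun q : ℝ × ℝ => ppKernelSummand β Λ q.1 q.2 n) = fun q : ℝ × ℝ =>
        (((uvWeightFn Λ (ppFreq β n) q.1 : ℂ) * (I * ((-ppFreq β n : ℝ) : ℂ) + (q.1 : ℂ))⁻¹) *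
          ((uvWeightFn Λ (ppFreq β n) q.2 : ℂ) * (I * ppFreq β n + (q.2 : ℂ))⁻¹)).re :=
      funext fun q => ppKernelSummand_eq_re_prod β Λ q.1 q.2 n
    rw [hfun']
    exact Complex.reCLM.contDiff.comp (((contDiff_weightMoebius Λ (ppFreq β n) (neg_ne_zero.2 hω.ne')).comp contDiff_fst).mul
      ((contDiff_weightMoebius Λ (ppFreq β n) hω.ne').comp contDiff_snd))
  exact contDiff_tsum (N := (⊤ : ℕ∞)) hsummand
    (v := fun m n => 2 ^ m * ((m + 1)! * (8 * ((m ! : ℝ)) ^ 2 * (342 : ℝ) ^ m) * (max (max (4 / Λ) (β / π)) 1) ^ m) ^ 2 * (1 / (ppFreq β n ^ 2 + 0 ^ 2)))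
    (fun m _ => (summable_one_div_ppFreq_sq_add_sq hβ 0).mul_left _)
    (fun m n p _ => norm_iteratedFDeriv_ppKernelSummand₂_le hβ hΛ (salmhoferCutoff_jets_le_flat m) n p)

/-- **`A_s` is jointly `C^∞`** (smooth profile `κ`, `0 < lo`). [cite: BenfattoGiulianiMastropietro2006, §2.4 (2.36)] -/
theorem contDiff_ppFarKernelS₂ {β Λ : ℝ} (hβ : 0 < β) (hΛ : 0 < Λ) {lo : ℝ} (hlo : 0 < lo) {κ : ℝ → ℝ} (hκ : ContDiff ℝ (⊤ : ℕ∞) κ) :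
    ContDiff ℝ (⊤ : ℕ∞) fun p : ℝ × ℝ => ppFarKernelS β Λ κ lo p.1 p.2 := by
  unfold ppFarKernelS
  exact (contDiff_ppTrueKernel₂ hβ hΛ).mul (contDiff_comp_ppSmoothRatio₂ hlo hκ)

/-- **`M_s` is jointly `C^∞`**. [cite: BenfattoGiulianiMastropietro2006, §2.4 (2.36)] -/
theorem contDiff_ppMidKernelS₂ {β Λ : ℝ} (hβ : 0 < β) (hΛ : 0 < Λ) {lo : ℝ} (hlo : 0 < lo) {κ : ℝ → ℝ} (hκ : ContDiff ℝ (⊤ : ℕ∞) κ) :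
    ContDiff ℝ (⊤ : ℕ∞) fun p : ℝ × ℝ => ppMidKernelS β Λ κ lo p.1 p.2 := by
  unfold ppMidKernelS
  exact (contDiff_ppTrueKernel₂ hβ hΛ).mul (contDiff_midFactor₂ hlo hκ)

/-- **The slice jets of a jointly smooth function are jointly smooth**: `ContDiff ℝ ∞ g ⟹ ContDiff ℝ ∞ (fun q => iteratedDeriv a (fun w => g (q.1, w)) q.2)`
(the jet is `D^a g(q)` evaluated at `(inr 1, …, inr 1)`). [folklore] -/
theorem contDiff_iteratedDeriv_slice₂ {g : ℝ × ℝ → ℝ} (hg : ContDiff ℝ (⊤ : ℕ∞) g) (a : ℕ) :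
    ContDiff ℝ (⊤ : ℕ∞) fun q : ℝ × ℝ => iteratedDeriv a (fun w : ℝ => g (q.1, w)) q.2 := by
  have ha : ((a : ℕ∞) : WithTop ℕ∞) ≤ ((⊤ : ℕ∞) : WithTop ℕ∞) := by exact_mod_cast le_top
  have hfun : (fun q : ℝ × ℝ => iteratedDeriv a (fun w : ℝ => g (q.1, w)) q.2) =
      fun q : ℝ × ℝ => (iteratedFDeriv ℝ a g q) (fun _ => ContinuousLinearMap.inr ℝ ℝ ℝ 1) := by
    funext q
    rw [iteratedDeriv_eq_iteratedFDeriv, iteratedFDeriv_slice_right_eq isOpen_univ hg.contDiffOn (mem_univ q.1) ha q.2]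
    rfl
  rw [hfun]
  have hmn : ((⊤ : ℕ∞) : WithTop ℕ∞) + (a : ℕ) ≤ ((⊤ : ℕ∞) : WithTop ℕ∞) := by
    exact_mod_cast (le_of_eq (top_add (a : ℕ∞)) : (⊤ : ℕ∞) + a ≤ ⊤)
  have hD : ContDiff ℝ (⊤ : ℕ∞) (iteratedFDeriv ℝ a g) := hg.iteratedFDeriv_right (m := ((⊤ : ℕ∞) : WithTop ℕ∞)) hmn
  exact (ContinuousMultilinearMap.apply ℝ (fun _ : Fin a => ℝ × ℝ) ℝ (fun _ => ContinuousLinearMap.inr ℝ ℝ ℝ 1)).contDiff.comp hD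

/-- **Every `u`-jet of `P` is a jointly smooth function of the two levels**: `ContDiff ℝ ∞ (fun q => iteratedDeriv a (fun w => ppTrueKernel β Λ q.1 w) q.2)` —
hence every mixed jet `∂ₑᵇ∂ᵤᵃP` exists and is continuous. [cite: BenfattoGiulianiMastropietro2006, §2.4 (2.36)] -/
theorem contDiff_jet_ppTrueKernel₂ {β Λ : ℝ} (hβ : 0 < β) (hΛ : 0 < Λ) (a : ℕ) :
    ContDiff ℝ (⊤ : ℕ∞) fun q : ℝ × ℝ => iteratedDeriv a (fun w : ℝ => ppTrueKernel β Λ q.1 w) q.2 :=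
  contDiff_iteratedDeriv_slice₂ (contDiff_ppTrueKernel₂ hβ hΛ) a

end Summit.HubbardSuperconductivity.HubbardSuperconductivity.Theorems.C4a

end
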